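/-
Origin: expansion seat `planner-pub-hodgecm-pv10-g4-0`, handover #3 2026-08-18T10:43:08Z (`HOME/pub-hodgecm-pv10-g4/lean/Pv10g4/UnitaryClassNumber.lean`, md5 93ebcea1, 218 lines);
landed by the gen-7 packager in gate run 28 as `HodgeCM/PerL34/UnitaryClassNumber.lean` (stripped 3 #print/#check/#eval lines).
-/
/-
Origin: pub-hodgecm cell, seat pv10-g4 (unit `pub-hodgecm-pv10-g4`, DAG-node prover #10, gen 4), 2026-08-18.
WIP module `Pv10g4.UnitaryClassNumber`; intended landing place `HodgeCM/PerL34/UnitaryClassNumber.lean`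
(no import rewrite needed: all four imports are tree / Mathlib modules).
-/
import Mathlib.GroupTheory.DoubleCoset
import Summits.HodgeConjecture.HodgeCM.PerL34.GodementCompact_2
import Summits.HodgeConjecture.HodgeCM.PerL34.AdelicUnitaryFactorisation
import Summits.HodgeConjecture.HodgeCM.Proofs.LandherrIsotropy

/-!
# Finiteness of the class number of an anisotropic unitary group (PerL v5 l. 70, KERNEL)

PerL v5 ll. 69–71: "For a compact open `K_f ⊂ G_U(𝔸_{L₀,f})` put
`S(K_f) := G_U(L₀)\(𝔹² × G_U(𝔸_{L₀,f})/K_f)`, **a finite union** of quotients `Γ_j\𝔹²` by the congruence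
subgroups `Γ_j = G_U(L₀) ∩ g_jK_fg_j⁻¹`."  The index set of that union is the double coset space
`G_U(L₀)\G_U(𝔸_{L₀,f})/K_f`, and its finiteness — the finiteness of the CLASS NUMBER of `G_U` — is the
content of the words "a finite union" (likewise Getz–Hahn (15.1)–(15.2) "this is a finite union of locally
symmetric spaces `⊔_{i∈I} Γᵢ\X`", quoted in `StubTree/PairingFromMatsushima` and `StubTree/ComponentTower`).
This file proves it in the kernel, for every OPEN `K_f` and every ANISOTROPIC `H` (so for PerL's `G_U`
whenever `[L:ℚ] ≠ 2`), from the compactness of `[U(H)]` (`Godement.compactSpace_adelicUnitaryQuot`, pv10-g3,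
run 27) and pv06-g4's factorisation `U(H)(𝔸_{L⁺}) ≃ₜ* U(H)_∞ × U(H)(𝔸_{L⁺,f})`:

* §1 (abstract, any topological group): `finite_doubleCosetQuotient_of_isOpen` — if `G ⧸ Γ` is compact and
  `K ≤ G` is an OPEN subgroup then `K \ G / Γ` is finite (the images in `G ⧸ Γ` of the classes form a
  disjoint open cover of a compact space); `finite_doubleCosetQuotient_of_isOpen'` — so is `Γ \ G / K`.
* §2 (adelic): `finite_doubleCoset_adelicUnitaryGroup` — `K \ U(H)(𝔸_{L⁺}) / U(H)(L⁺)` is finite for every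
  open subgroup `K` and every anisotropic `H ∈ M_n(L)`.
* §3 (PerL's index set): `finProj : U(H)(𝔸_{L⁺}) →* U(H)(𝔸_{L⁺,f})`, `ratFin L H = U(H)(L⁺) ≤ U(H)(𝔸_{L⁺,f})`,
  **`finite_doubleCoset_ratFin`**: `U(H)(L⁺) \ U(H)(𝔸_{L⁺,f}) / K_f` is finite for every open `K_f`;
  **`HermSpace3.finite_doubleCoset_ratFin`**: for every `V : HermSpace3 L ι₁` over a CM field with
  `[L:ℚ] ≠ 2`, `G_U(L₀)\G_U(𝔸_{L₀,f})/K_f` is finite — PerL v5 l. 70 "a finite union".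

Pure kernel mathematics over Mathlib + the package; nothing cited, nothing posited; closures are the standard trio.
(For the record: the statement is the finiteness of class numbers of algebraic groups, Borel 1963 /
Platonov–Rapinchuk Thm 5.1, here in the anisotropic case where it is a corollary of compactness.)
-/

set_option autoImplicit false

noncomputable section

open scoped Pointwise MatrixGroups
open NumberField IsDedekindDomain
open Literature.AlgebraicGeometry.ShimuraVarieties
open HodgeCM.Adelic HodgeCM.PerL34.AdelicUnitaryFactorisation

namespace HodgeCM.PerL34.Godement

/-! ## §1 Open subgroups have finitely many double cosets modulo a cocompact subgroup -/

section Abstract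

variable {G : Type*} [Group G] [TopologicalSpace G] [IsTopologicalGroup G]

/-- For an OPEN subgroup `K`, every class of `K \ G / Γ` is an open subset of `G`. -/
theorem isOpen_setOf_doubleCosetMk_eq (K Γ : Subgroup G) (hK : IsOpen (K : Set G))
    (q : DoubleCoset.Quotient (K : Set G) (Γ : Set G)) :
    IsOpen {g : G | DoubleCoset.mk K Γ g = q} := by
  rw [isOpen_iff_forall_mem_open]
  intro g hg
  refine ⟨(K : Set G) * {g}, ?_, hK.mul_right, ⟨1, K.one_mem, g, Set.mem_singleton g, one_mul g⟩⟩
  rintro _ ⟨k, hk, y, hy, rfl⟩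
  rw [Set.mem_singleton_iff.mp hy, Set.mem_setOf_eq, ← hg]
  exact ((DoubleCoset.eq K Γ g (k * g)).mpr ⟨k, hk, 1, Γ.one_mem, (mul_one _).symm⟩).symm

/-- **An open subgroup of a group with cocompact `Γ` has finitely many double cosets `K \ G / Γ`.**
The images in `G ⧸ Γ` of the classes of `K \ G / Γ` are open (the quotient map is open), pairwise
disjoint, non-empty and cover; a compact space has only finitely many such sets. -/
theorem finite_doubleCosetQuotient_of_isOpen (K Γ : Subgroup G) (hK : IsOpen (K : Set G))
    [CompactSpace (G ⧸ Γ)] : Finite (DoubleCoset.Quotient (K : Set G) (Γ : Set G)) := by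
  classical
  -- two classes whose images in `G ⧸ Γ` meet are equal
  have hdisj : ∀ (q q' : DoubleCoset.Quotient (K : Set G) (Γ : Set G)) (x : G ⧸ Γ),
      x ∈ QuotientGroup.mk '' {g : G | DoubleCoset.mk K Γ g = q} →
      x ∈ QuotientGroup.mk '' {g : G | DoubleCoset.mk K Γ g = q'} → q = q' := by
    rintro q q' x ⟨g, hg, rfl⟩ ⟨g', hg', hgg'⟩
    rw [Set.mem_setOf_eq] at hg hg'
    rw [← hg, ← hg']
    have hγ : g⁻¹ * g' ∈ Γ := (QuotientGroup.eq (s := Γ)).mp hgg'.symm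
    exact (DoubleCoset.eq K Γ g g').mpr ⟨1, K.one_mem, g⁻¹ * g', hγ, by rw [one_mul, mul_inv_cancel_left]⟩
  obtain ⟨t, ht⟩ := (isCompact_univ : IsCompact (Set.univ : Set (G ⧸ Γ))).elim_finite_subcover
    (fun q : DoubleCoset.Quotient (K : Set G) (Γ : Set G) =>
      QuotientGroup.mk '' {g : G | DoubleCoset.mk K Γ g = q})
    (fun q => QuotientGroup.isOpenMap_coe _ (isOpen_setOf_doubleCosetMk_eq K Γ hK q))
    (by
      rintro x -
      obtain ⟨g, rfl⟩ := QuotientGroup.mk_surjective x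
      exact Set.mem_iUnion.2 ⟨DoubleCoset.mk K Γ g, g, rfl, rfl⟩)
  -- every class meets the finite subcover, hence belongs to it
  have hall : ∀ q : DoubleCoset.Quotient (K : Set G) (Γ : Set G), q ∈ t := by
    intro q
    obtain ⟨g, rfl⟩ := q.exists_rep
    have hx : (QuotientGroup.mk g : G ⧸ Γ) ∈ ⋃ q ∈ t, QuotientGroup.mk '' {g' : G | DoubleCoset.mk K Γ g' = q} :=
      ht (Set.mem_univ _)
    obtain ⟨q', hq't, hx'⟩ := Set.mem_iUnion₂.mp hx
    have hqq' : (⟦g⟧ : DoubleCoset.Quotient (K : Set G) (Γ : Set G)) = q' := hdisj _ _ _ ⟨g, rfl, rfl⟩ hx'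
    rwa [hqq']
  exact Set.finite_univ_iff.mp (t.finite_toSet.subset fun q _ => Finset.mem_coe.mpr (hall q))

/-- The same finiteness for `Γ \ G / K` (inversion `g ↦ g⁻¹` exchanges the two double coset spaces). -/
theorem finite_doubleCosetQuotient_of_isOpen' (K Γ : Subgroup G) (hK : IsOpen (K : Set G))
    [CompactSpace (G ⧸ Γ)] : Finite (DoubleCoset.Quotient (Γ : Set G) (K : Set G)) := by
  haveI := finite_doubleCosetQuotient_of_isOpen K Γ hK
  let f : DoubleCoset.Quotient (K : Set G) (Γ : Set G) → DoubleCoset.Quotient (Γ : Set G) (K : Set G) :=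
    Quotient.lift (fun g : G => DoubleCoset.mk Γ K g⁻¹) (by
      intro a b hab
      obtain ⟨k, hk, γ, hγ, rfl⟩ := DoubleCoset.rel_iff.mp hab
      exact (DoubleCoset.eq Γ K _ _).mpr
        ⟨γ⁻¹, Γ.inv_mem hγ, k⁻¹, K.inv_mem hk, by simp only [mul_inv_rev, mul_assoc]⟩)
  refine Finite.of_surjective f fun q => ?_
  obtain ⟨g, rfl⟩ := q.exists_rep
  refine ⟨DoubleCoset.mk K Γ g⁻¹, ?_⟩
  show DoubleCoset.mk Γ K g⁻¹⁻¹ = _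
  rw [inv_inv]

end Abstract

/-! ## §2 The adelic unitary group of an anisotropic hermitian matrix -/

section Adelic

variable (L : CMField)

local notation "𝔸L" => AdeleRing (𝓞 L) L

/-- **Anisotropic ⇒ finite class numbers**: for every OPEN subgroup `K ≤ U(H)(𝔸_{L⁺})` the double coset
space `K \ U(H)(𝔸_{L⁺}) / U(H)(L⁺)` is finite. -/
theorem finite_doubleCoset_adelicUnitaryGroup {n : ℕ} (H : Matrix (Fin n) (Fin n) L)
    (ha : IsAnisotropic L H) (K : Subgroup (adelicUnitaryGroup L H))
    (hK : IsOpen (K : Set (adelicUnitaryGroup L H))) :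
    Finite (DoubleCoset.Quotient (K : Set (adelicUnitaryGroup L H))
      (adelicUnitaryRat L H : Set (adelicUnitaryGroup L H))) := by
  haveI : CompactSpace (adelicUnitaryGroup L H ⧸ adelicUnitaryRat L H) :=
    compactSpace_adelicUnitaryQuot L H ha
  exact finite_doubleCosetQuotient_of_isOpen K _ hK

/-- The same for `U(H)(L⁺) \ U(H)(𝔸_{L⁺}) / K`. -/
theorem finite_doubleCoset_adelicUnitaryGroup' {n : ℕ} (H : Matrix (Fin n) (Fin n) L)
    (ha : IsAnisotropic L H) (K : Subgroup (adelicUnitaryGroup L H))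
    (hK : IsOpen (K : Set (adelicUnitaryGroup L H))) :
    Finite (DoubleCoset.Quotient (adelicUnitaryRat L H : Set (adelicUnitaryGroup L H))
      (K : Set (adelicUnitaryGroup L H))) := by
  haveI : CompactSpace (adelicUnitaryGroup L H ⧸ adelicUnitaryRat L H) :=
    compactSpace_adelicUnitaryQuot L H ha
  exact finite_doubleCosetQuotient_of_isOpen' K _ hK

/-! ## §3 PerL's index set `G_U(L₀)\G_U(𝔸_{L₀,f})/K_f` -/

variable {n : Type} [Fintype n] [DecidableEq n]

/-- The finite-adelic projection `U(H)(𝔸_{L⁺}) →* U(H)(𝔸_{L⁺,f})` (second component of pv06-g4's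
`splitEquiv : U(H)(𝔸_{L⁺}) ≃ₜ* U(H)_∞ × U(H)(𝔸_{L⁺,f})`). -/
def finProj (H : Matrix n n L) : adelicUnitaryGroup L H →* Ufin L H :=
  (MonoidHom.snd (Uinf L H) (Ufin L H)).comp (splitEquiv L H).toMulEquiv.toMonoidHom

/-- (Ported verbatim from the HodgeCMPerL package; no docstring in the source.) -/
theorem finProj_apply (H : Matrix n n L) (g : adelicUnitaryGroup L H) :
    finProj L H g = (splitEquiv L H g).2 := rfl

/-- (Ported verbatim from the HodgeCMPerL package; no docstring in the source.) -/
theorem continuous_finProj (H : Matrix n n L) : Continuous (finProj L H) :=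
  continuous_snd.comp (splitEquiv L H).continuous

/-- (Ported verbatim from the HodgeCMPerL package; no docstring in the source.) -/
@[simp] theorem finProj_ιf (H : Matrix n n L) (k : Ufin L H) : finProj L H (ιf L H k) = k := by
  rw [finProj_apply, splitEquiv_ιf]

/-- (Ported verbatim from the HodgeCMPerL package; no docstring in the source.) -/
theorem finProj_surjective (H : Matrix n n L) : Function.Surjective (finProj L H) :=
  fun k => ⟨ιf L H k, finProj_ιf L H k⟩

/-- `U(H)(L⁺)` as a subgroup of `U(H)(𝔸_{L⁺,f})` (finite-adelic components of the diagonally embedded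
rational unitary matrices). -/
def ratFin (H : Matrix n n L) : Subgroup (Ufin L H) := (adelicUnitaryRat L H).map (finProj L H)

/-- (Ported verbatim from the HodgeCMPerL package; no docstring in the source.) -/
theorem finProj_mem_ratFin (H : Matrix n n L) {γ : adelicUnitaryGroup L H} (hγ : γ ∈ adelicUnitaryRat L H) :
    finProj L H γ ∈ ratFin L H :=
  Subgroup.mem_map_of_mem (finProj L H) hγ

/-- **Finiteness of the class number of an anisotropic unitary group** (PerL's index set): for every OPEN
subgroup `K_f ≤ U(H)(𝔸_{L⁺,f})`, `U(H)(L⁺) \ U(H)(𝔸_{L⁺,f}) / K_f` is finite. -/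
theorem finite_doubleCoset_ratFin {m : ℕ} (H : Matrix (Fin m) (Fin m) L) (ha : IsAnisotropic L H)
    (Kf : Subgroup (Ufin L H)) (hKf : IsOpen (Kf : Set (Ufin L H))) :
    Finite (DoubleCoset.Quotient (ratFin L H : Set (Ufin L H)) (Kf : Set (Ufin L H))) := by
  haveI := finite_doubleCoset_adelicUnitaryGroup' L H ha (Kf.comap (finProj L H))
    (hKf.preimage (continuous_finProj L H))
  let f : DoubleCoset.Quotient (adelicUnitaryRat L H : Set (adelicUnitaryGroup L H))
      (Kf.comap (finProj L H) : Set (adelicUnitaryGroup L H)) →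
      DoubleCoset.Quotient (ratFin L H : Set (Ufin L H)) (Kf : Set (Ufin L H)) :=
    Quotient.lift (fun g => DoubleCoset.mk (ratFin L H) Kf (finProj L H g)) (by
      intro a b hab
      obtain ⟨γ, hγ, k, hk, rfl⟩ := DoubleCoset.rel_iff.mp hab
      refine (DoubleCoset.eq _ _ _ _).mpr ⟨finProj L H γ, finProj_mem_ratFin L H hγ, finProj L H k, hk, ?_⟩
      rw [map_mul, map_mul])
  refine Finite.of_surjective f fun q => ?_
  obtain ⟨x, rfl⟩ := q.exists_rep
  refine ⟨DoubleCoset.mk _ _ (ιf L H x), ?_⟩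
  show DoubleCoset.mk _ _ (finProj L H (ιf L H x)) = _
  rw [finProj_ιf]

/-- **PerL v5 l. 70 "a finite union" (KERNEL).**  For every `V : HermSpace3 L ι₁` over a CM field `L` with
`[L:ℚ] ≠ 2` (PerL: `[L:ℚ] ≥ 4`) and every open `K_f ≤ G_U(𝔸_{L₀,f})`, the index set
`G_U(L₀)\G_U(𝔸_{L₀,f})/K_f` of `S(K_f) = ⊔_j Γ_j\𝔹²` is finite. -/
theorem _root_.HodgeCM.HermSpace3.finite_doubleCoset_ratFin {ι₁ : L →+* ℂ} (V : HermSpace3 L ι₁)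
    (hL : Module.finrank ℚ L ≠ 2) (Kf : Subgroup (Ufin L V.Hm)) (hKf : IsOpen (Kf : Set (Ufin L V.Hm))) :
    Finite (DoubleCoset.Quotient (ratFin L V.Hm : Set (Ufin L V.Hm)) (Kf : Set (Ufin L V.Hm))) :=
  HodgeCM.PerL34.Godement.finite_doubleCoset_ratFin L V.Hm
    (fun x hx => by
      by_contra hne
      exact HermSpace3.not_isIsotropic_of_finrank_ne_two V hL ⟨x, hne, hx⟩)
    Kf hKf

end Adelic

end HodgeCM.PerL34.Godement

end

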